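import Summits.Ventures.Crystal3D.Bulk.GapHullConnected
import HarnessLib

/-!
# The total angular excess of the oriented faces: `Σ_F excess(F) = 4π · k` (`= 4π` for a connected
# tight graph) — (F2) of `phase2/LEAN-FACES-DESIGN.md` in the kernel

HONEST FRAMING. Part of the venture `Summits/Ventures/Crystal3D` (cell `pub-crystal3d`, phase 2;
seat typer-bulk-2). Kernel theorems about an admissible fourteen-ball configuration `c`
(`IsGapConfig c`, `intruderDist c < 3/2`); nothing here asserts anything about GAP(1.26), and the
connectedness of the tight graph (census assumption P-L3(b) L1, `TightConnected c`) is a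
HYPOTHESIS where it appears. Assembly of two landed pieces:

* the angle identity `IsGapConfig.oriented_euler_angle_identity` (`Bulk/GapOrientedFaces.lean`,
  this seat): `Σ_{F ∈ ofaces c} (ofaceAngleSum c F − (#F − 2)·π) = 2π·(V′ − E + F°)`;
* Euler's relation `IsGapConfig.oriented_euler'` (`Bulk/GapHullEuler.lean`, seat p3, on the
  generic deletion lemma `Bulk/RotSysEuler.lean`): `V′ − E + F° = 2k`, `k = RotSys.numK` of the
  tight darts in the hull rotation system, `= 1` iff `TightConnected c` (`Bulk/GapHullConnected`).

Results: **`IsGapConfig.sum_ofaceExcess_eq`**: the total angular excess of the oriented faces is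
`4π·k`; **`IsGapConfig.sum_ofaceExcess_of_tightConnected`**: it is exactly `4π` (the area of the
unit sphere) when the tight graph is connected; `IsGapConfig.four_pi_le_sum_ofaceExcess`: it is
`≥ 4π` as soon as there is a tight pair. This is the budget identity the face census (P-L3) spends:
each oriented face contributes its corner sum minus `(#F − 2)π`.
-/

noncomputable section

namespace Summit.Ventures.Crystal3D

open Finset Equiv HullRotSys

variable {c : Fin 14 → EuclideanSpace ℝ (Fin 3)}

/-- **Total angular excess `= 4π · k`** (`k` = number of connected components of the oriented
tight map, as in `IsGapConfig.oriented_euler`). -/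
theorem IsGapConfig.sum_ofaceExcess_eq (hc : IsGapConfig c) (hD : intruderDist c < 3 / 2) :
    ∑ F ∈ ofaces c, (ofaceAngleSum c F - ((F.card : ℝ) - 2) * Real.pi) =
      4 * Real.pi * (RotSys.numK hc.hullRot (inv (dirSet c)) (tightDartsH c) : ℝ) := by
  have hD3 : intruderDist c ^ 2 < 3 := by
    have hD1 := hc.one_le_intruderDist
    nlinarith
  rw [hc.oriented_euler_angle_identity hD3]
  have h := hc.oriented_euler' hD
  have h' : ((activeVertices c).card : ℝ) - tightCount c + onumFaces c =
      2 * (RotSys.numK hc.hullRot (inv (dirSet c)) (tightDartsH c) : ℝ) := by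
    exact_mod_cast h
  rw [h']
  ring

/-- **Total angular excess `= 4π` for a connected tight graph** (with at least one tight pair):
`Σ_{F ∈ ofaces c} (ofaceAngleSum c F − (#F − 2)·π) = 4π`. -/
theorem IsGapConfig.sum_ofaceExcess_of_tightConnected (hc : IsGapConfig c)
    (hD : intruderDist c < 3 / 2) (hconn : TightConnected c) (hne : (darts c).Nonempty) :
    ∑ F ∈ ofaces c, (ofaceAngleSum c F - ((F.card : ℝ) - 2) * Real.pi) = 4 * Real.pi := by
  rw [hc.sum_ofaceExcess_eq hD, hc.numK_eq_one_of_tightConnected hD hconn hne]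
  simp

/-- **Total angular excess `≥ 4π`** as soon as there is a tight pair (`k ≥ 1`). -/
theorem IsGapConfig.four_pi_le_sum_ofaceExcess (hc : IsGapConfig c) (hD : intruderDist c < 3 / 2)
    (hne : (darts c).Nonempty) :
    4 * Real.pi ≤ ∑ F ∈ ofaces c, (ofaceAngleSum c F - ((F.card : ℝ) - 2) * Real.pi) := by
  rw [hc.sum_ofaceExcess_eq hD]
  obtain ⟨q, hq⟩ := hne
  have hT : (tightDartsH c).Nonempty :=
    ⟨⟨dirPair c q, hc.dirPair_mem_hullDarts hD hq⟩, mem_tightDartsH.2 ⟨q, hq, rfl⟩⟩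
  have hk : 1 ≤ RotSys.numK hc.hullRot (inv (dirSet c)) (tightDartsH c) := by
    unfold RotSys.numK
    exact RotSys.numClasses_pos _ hT
  have hk' : (1 : ℝ) ≤ (RotSys.numK hc.hullRot (inv (dirSet c)) (tightDartsH c) : ℝ) := by
    exact_mod_cast hk
  nlinarith [Real.pi_pos]

end Summit.Ventures.Crystal3D
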